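import Mathlib.Data.Nat.Log
import Literature.Computability.Complexity.AmanoMaruoka
import Literature.Computability.Complexity.MonotoneSwitching
import Literature.Computability.Complexity.CliqueCounting
import Literature.Computability.Complexity.CliqueRestriction
import HarnessLib

/-!
# Proof of the Amano–Maruoka fact `Literature.Computability.Complexity.amano_maruoka`

`amano_maruoka_holds : amano_maruoka` — circuits over `{∧₂, ∨₂, ¬}` with at most
`⌊(1/6) log₂ log₂ m⌋` NOT gates computing `CLIQUE(m, s(m))` have superpolynomial size, for a
suitable clique size `s(m)` (Amano–Maruoka 2005, main theorem; Jukna 2012, §10.5).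

The printed proof (Amano–Maruoka 2005) combines a Håstad-style restriction argument, which
removes the NOT gates one at a time, with the monotone approximation method. The paper itself
being unavailable to us, the proof below is a reconstruction of this architecture from the
standard references (all steps are formalized, nothing is assumed):

1. **Criterion** (`MonotoneSwitching.lean`, Jukna 2012, Thm 9.17): the monotone function `g`
   fed into the *first* NOT gate is computed by the NOT-free prefix of the program, so for
   `r = s = w` there are an exact `w`-CNF `C` (`|C| ≤ t (w-1)^w`), an exact `w`-DNF `D`
   (`|D| ≤ t (w-1)^w`) and `|I| ≤ w - 1` with `C ≤ g` or `g ≤ D ∨ ⋁ I`.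
2. **Dichotomy** (`clique_dichotomy`, counting from `CliqueCounting.lean`, Jukna 2012, Thm 9.26): in
   the first case some colouring `h` of the vertices with `c` colours has `g = 1` on its
   coclique restricted to the live vertices; in the second case some `q`-set `Q` of live
   vertices has `g = 0` on its clique.
3. **Kill** (`CliqueRestriction.lean`, Jukna 2012, §10.5, proof of Claim 10.22): restricting the
   live vertices to a monochromatic part `W` of `h` (dead edges frozen to the coclique), resp. to
   `Q` (dead edges frozen to `0`), makes `g` constant, so the NOT gate becomes a constant gate;
   the computed function stays an `(a - c, b)`-, resp. `(a, b)`-clique function on the new live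
   set (Jukna 2012, §9.8), of which `CLIQUE(m, s)` is the case `(s - 1, s)` on all vertices.
4. **Induction** on the NOT budget (`cliqueLike_induction`); with no NOT gate left the same
   dichotomy contradicts clique-likeness. This gives the finite theorem
   `le_size_of_computes_cliqueFn` under explicit numerical side conditions.
5. **Numerics** (`amano_maruoka_holds`): with `L = log₂ m`, `K = log₂ L`, budget `R = K / 6`,
   `c = 2 ^ (L / (R + 3) - 1)`, `d = (R + 3)(K + 1)`, `w = 2 d²`, `s = (R + 2) c`, the side
   conditions hold for all large `m`, for every fixed exponent `k`.

## References

* K. Amano, A. Maruoka, *A superpolynomial lower bound for a circuit computing the clique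
  function with at most (1/6) log log n negation gates*, SIAM J. Comput. 35 (2005) 201–216
  [AmanoMaruoka2005].
* S. Jukna, *Boolean Function Complexity: Advances and Frontiers*, Springer (2012), §9.4
  (Thm 9.17, 9.18), §9.8 (Thm 9.26), §10.5 (Thm 10.21 and the remark on Amano–Maruoka)
  [Jukna2012].
-/

namespace Literature.Computability.Complexity

open Finset GateList

variable {m : ℕ}

/-! ### The dichotomy for a NOT-free program -/

/-- `(d choose 2) < w` whenever `2 d² ≤ w` and `2 ≤ w`. [folklore] -/
theorem choose_two_lt_of_two_mul_sq_le {d w : ℕ} (hw : 2 ≤ w) (hdw : 2 * d ^ 2 ≤ w) :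
    d.choose 2 < w := by
  rcases Nat.eq_zero_or_pos d with rfl | hd
  · rw [Nat.choose_zero_succ]; omega
  · have h1 : d.choose 2 ≤ d * (d - 1) := by
      rw [Nat.choose_two_right]; exact Nat.div_le_self _ _
    have h2 : d * (d - 1) ≤ d ^ 2 := by rw [pow_two]; exact Nat.mul_le_mul_left d (Nat.sub_le d 1)
    have h3 : d ^ 2 < 2 * d ^ 2 := by
      have : 0 < d ^ 2 := Nat.pow_pos hd
      omega
    omega

/-- **The dichotomy** (Jukna 2012, Thm 9.17 with the counting of Thm 9.26, Cases 1–2). Let a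
well-formed NOT-free program `pre` over `{∧₂, ∨₂, 0, 1}` with output wire `w₀` compute `g`, and
let `V` be the live vertices, `q c ≤ #V`, `2 ≤ q`, `d ≤ q`, `2 d² ≤ w`, `4 (w-1) ≤ c²`,
`|pre| (w-1)^w < c^d` and `4 |pre| (w-1)^w ≤ c^d`. Then either some colouring `h` with `c`
colours has `g (colorTest V h) = 1`, or some `q`-subset `Q ⊆ V` has `g (cliqueVec Q) = 0`.
[cite: Jukna2012, Thm. 9.26] -/
theorem clique_dichotomy (pre : List (Gate (⊤ : SimpleGraph (Fin m)).edgeSet)) (hwf : WF pre)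
    (hB : ∀ g ∈ pre, g.fn ∈ monotoneBasis01) (w₀ : (⊤ : SimpleGraph (Fin m)).edgeSet ⊕ ℕ)
    (hw₀ : OutOK pre.length w₀) (V : Finset (Fin m)) {c d w q : ℕ} (hc : 1 ≤ c) (hw : 2 ≤ w)
    (hdw : 2 * d ^ 2 ≤ w) (h1 : pre.length * (w - 1) ^ w < c ^ d)
    (h0 : 4 * (pre.length * (w - 1) ^ w) ≤ c ^ d) (hI : 4 * (w - 1) ≤ c ^ 2) (hq : q * c ≤ #V)
    (hdq : d ≤ q) (h2q : 2 ≤ q) :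
    (∃ h : Fin m → Fin c, wireOf (colorTest V h) (vals pre (colorTest V h)) w₀ = true) ∨
      ∃ Q ⊆ V, #Q = q ∧ wireOf (cliqueVec Q) (vals pre (cliqueVec Q)) w₀ = false := by
  obtain ⟨C, D, I, hC, hD, hcC, hcD, hcI, hdich⟩ :=
    GateList.lowerBoundsCriterion pre hwf hB w₀ hw₀ (r := w) (s := w) hw hw
  rcases hdich with hlow | hupp
  · -- Case `C ≤ g`: a good colouring makes every clause bichromatic or dead
    left
    set 𝒮 : Finset (Finset (Sym2 (Fin m))) :=
      (C.filter fun S => ∀ e ∈ S, IsLive V e).image fun S => S.image Subtype.val with h𝒮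
    have h𝒮prop : ∀ S' ∈ 𝒮, (∀ e ∈ S', ¬ e.IsDiag) ∧ 2 * d ^ 2 ≤ #S' := by
      intro S' hS'
      obtain ⟨S, hS, rfl⟩ := Finset.mem_image.1 hS'
      refine ⟨fun e he => ?_, ?_⟩
      · obtain ⟨e', -, rfl⟩ := Finset.mem_image.1 he
        exact not_isDiag_edge e'
      · rw [Finset.card_image_of_injective _ Subtype.val_injective,
          hC S (Finset.mem_filter.1 hS).1]
        exact hdw
    have h𝒮card : #𝒮 < c ^ d :=
      calc #𝒮 ≤ #(C.filter fun S => ∀ e ∈ S, IsLive V e) := Finset.card_image_le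
        _ ≤ #C := Finset.card_filter_le _ _
        _ ≤ pre.length * (w - 1) ^ w := hcC
        _ < c ^ d := h1
    obtain ⟨h, hgood⟩ := exists_good_coloring hc d 𝒮 h𝒮prop h𝒮card
    refine ⟨h, hlow _ fun S hS => ?_⟩
    by_cases hlive : ∀ e ∈ S, IsLive V e
    · obtain ⟨e', he', hbi⟩ := hgood (S.image Subtype.val)
        (Finset.mem_image.2 ⟨S, Finset.mem_filter.2 ⟨hS, hlive⟩, rfl⟩)
      obtain ⟨e, he, rfl⟩ := Finset.mem_image.1 he'
      refine ⟨e, he, ?_⟩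
      simp only [colorTest, Bool.not_eq_true', decide_eq_false_iff_not, not_and]
      exact fun _ => hbi
    · push Not at hlive
      obtain ⟨e, he, hdead⟩ := hlive
      refine ⟨e, he, ?_⟩
      simp only [colorTest, Bool.not_eq_true', decide_eq_false_iff_not, not_and]
      exact fun hl => absurd hl hdead
  · -- Case `g ≤ ⋁ I ∨ D`: a good clique avoids `I` and every monomial
    right
    set 𝒟 : Finset (Finset (Sym2 (Fin m))) := D.image fun P => P.image Subtype.val with h𝒟
    set I' : Finset (Sym2 (Fin m)) := I.image Subtype.val with hI'
    have h𝒟prop : ∀ P' ∈ 𝒟, d.choose 2 < #P' := by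
      intro P' hP'
      obtain ⟨P, hP, rfl⟩ := Finset.mem_image.1 hP'
      rw [Finset.card_image_of_injective _ Subtype.val_injective, hD P hP]
      exact choose_two_lt_of_two_mul_sq_le hw hdw
    have hI'prop : ∀ e ∈ I', ¬ e.IsDiag := by
      intro e he
      obtain ⟨e', -, rfl⟩ := Finset.mem_image.1 he
      exact not_isDiag_edge e'
    have h𝒟4 : 4 * #𝒟 ≤ c ^ d :=
      (Nat.mul_le_mul_left 4 (Finset.card_image_le.trans hcD)).trans h0
    have hI'4 : 4 * #I' ≤ c ^ 2 :=
      (Nat.mul_le_mul_left 4 (Finset.card_image_le.trans hcI)).trans hI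
    obtain ⟨Q, hQV, hQcard, hQD, hQI⟩ :=
      exists_good_clique V hc hq hdq h2q 𝒟 h𝒟prop I' hI'prop h𝒟4 hI'4
    refine ⟨Q, hQV, hQcard, ?_⟩
    rw [Bool.eq_false_iff]
    intro hne
    rcases hupp _ hne with ⟨e, heI, he⟩ | ⟨P, hP, hPsat⟩
    · obtain ⟨v, hv, hvQ⟩ := hQI e.val (Finset.mem_image_of_mem _ heI)
      rw [cliqueVec_eq_true_iff] at he
      exact hvQ (he v hv)
    · obtain ⟨e', he', v, hv, hvQ⟩ := hQD (P.image Subtype.val) (Finset.mem_image_of_mem _ hP)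
      obtain ⟨e, he, rfl⟩ := Finset.mem_image.1 he'
      have := hPsat e he
      rw [cliqueVec_eq_true_iff] at this
      exact hvQ (this v hv)

/-! ### The induction on the NOT budget -/

/-- A program over `{∧₂, ∨₂, ¬, 0, 1}` without NOT gates is over `{∧₂, ∨₂, 0, 1}`. [folklore] -/
theorem isOver_monotoneBasis01_of_negs_eq_zero {ι : Type*} {gs : List (Gate ι)}
    (hB : ∀ g ∈ gs, g.fn ∈ deMorganBasis01) (hnegs : negs gs = 0) :
    ∀ g ∈ gs, g.fn ∈ monotoneBasis01 := fun g hg =>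
  mem_monotoneBasis01_of_ne_not (hB g hg) fun hnot => by
    obtain ⟨pre, post, rfl⟩ := List.append_of_mem hg
    have : negs (pre ++ g :: post) = negs pre + (1 + negs post) := by simp [hnot]
    omega

/-- **Base case**: a NOT-free program computing an `(a, b)`-clique function on `V` violates the
dichotomy (Jukna 2012, Thm 9.26: clique-like functions need large monotone circuits).
[cite: Jukna2012, Thm. 9.26] -/
theorem cliqueLike_noNot_false {a b c d w q : ℕ} (hc : 1 ≤ c) (hw : 2 ≤ w) (hdw : 2 * d ^ 2 ≤ w)
    (hI : 4 * (w - 1) ≤ c ^ 2) (gs : List (Gate (⊤ : SimpleGraph (Fin m)).edgeSet))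
    (o : (⊤ : SimpleGraph (Fin m)).edgeSet ⊕ ℕ) (V : Finset (Fin m))
    (F : ((⊤ : SimpleGraph (Fin m)).edgeSet → Bool) → Bool) (hwf : WF gs)
    (hB : ∀ g ∈ gs, g.fn ∈ deMorganBasis01) (ho : OutOK gs.length o) (hnegs : negs gs = 0)
    (hF : ∀ x, wireOf x (vals gs x) o = F x) (hCL : CliqueLike V a b F)
    (h1 : gs.length * (w - 1) ^ w < c ^ d) (h0 : 4 * (gs.length * (w - 1) ^ w) ≤ c ^ d)
    (hq : q * c ≤ #V) (hdq : d ≤ q) (hbq : b ≤ q) (h2q : 2 ≤ q) (hca : c ≤ a) : False := by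
  rcases clique_dichotomy gs hwf (isOver_monotoneBasis01_of_negs_eq_zero hB hnegs) o ho V hc hw hdw h1
      h0 hI hq hdq h2q with ⟨h, hh⟩ | ⟨Q, hQV, hQ, hQ0⟩
  · rw [hF, hCL.rejects_of_le hca h] at hh
    exact Bool.false_ne_true hh
  · rw [hF, hCL.accepts_of_le hQV (hQ ▸ hbq)] at hQ0
    exact Bool.false_ne_true hQ0.symm

/-- **The induction** (Amano–Maruoka 2005, restriction argument; cf. Jukna 2012, §10.5, proof of
Thm 10.21). Fix `c ≥ 1`, `w ≥ 2 d²`, `w ≥ 2`, `4 T (w-1)^w ≤ c^d`, `4 (w-1) ≤ c²`, `d ≤ b`,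
`2 ≤ b`. Then no well-formed program over `{∧₂, ∨₂, ¬, 0, 1}` with at most `R` NOT gates and
`|gs| + 2R ≤ T` gates computes an `(a, b)`-clique function on a live set `V` with
`b ≤ #V / c^(R+1)` and `(R+1) c ≤ a`: kill the first NOT gate by the dichotomy (two more gates,
one NOT fewer, live set divided by `c`, `a` decreased by at most `c`) and recurse.
[cite: Jukna2012, §10.5] -/
theorem cliqueLike_induction {b c d w T : ℕ} (hc : 1 ≤ c) (hw : 2 ≤ w) (hdw : 2 * d ^ 2 ≤ w)
    (hT : 4 * (T * (w - 1) ^ w) ≤ c ^ d) (hI : 4 * (w - 1) ≤ c ^ 2) (hdb : d ≤ b) (h2b : 2 ≤ b) :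
    ∀ (R : ℕ) (gs : List (Gate (⊤ : SimpleGraph (Fin m)).edgeSet))
      (o : (⊤ : SimpleGraph (Fin m)).edgeSet ⊕ ℕ) (V : Finset (Fin m)) (a : ℕ)
      (F : ((⊤ : SimpleGraph (Fin m)).edgeSet → Bool) → Bool),
      WF gs → (∀ g ∈ gs, g.fn ∈ deMorganBasis01) → OutOK gs.length o → negs gs ≤ R →
      (∀ x, wireOf x (vals gs x) o = F x) → CliqueLike V a b F →
      gs.length + 2 * R ≤ T → b ≤ #V / c ^ (R + 1) → (R + 1) * c ≤ a → False := by
  have hcd : 0 < c ^ d := Nat.pow_pos (by omega)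
  -- numeric consequences of `|gs| ≤ T`
  have hnum : ∀ L : ℕ, L ≤ T → L * (w - 1) ^ w < c ^ d ∧ 4 * (L * (w - 1) ^ w) ≤ c ^ d := by
    intro L hL
    have h0 : 4 * (L * (w - 1) ^ w) ≤ c ^ d :=
      (Nat.mul_le_mul_left 4 (Nat.mul_le_mul_right _ hL)).trans hT
    exact ⟨by omega, h0⟩
  -- `b ≤ #V / c^(R+1)` gives `b ≤ #V / c`
  have hdiv : ∀ (n R : ℕ), b ≤ n / c ^ (R + 1) → b ≤ n / c := fun n R h =>
    h.trans (Nat.div_le_div_left (Nat.le_self_pow (by omega) c) (by omega))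
  intro R
  induction R with
  | zero =>
    intro gs o V a F hwf hB ho hnegs hF hCL hlen hbV hca
    obtain ⟨h1, h0⟩ := hnum gs.length (by omega)
    have hbq := hdiv _ _ hbV
    exact cliqueLike_noNot_false hc hw hdw hI gs o V F hwf hB ho (Nat.le_zero.1 hnegs) hF hCL h1 h0
      (Nat.div_mul_le_self _ _) (hdb.trans hbq) hbq (h2b.trans hbq) (by simpa using hca)
  | succ R ih =>
    intro gs o V a F hwf hB ho hnegs hF hCL hlen hbV hca
    have hbq := hdiv _ _ hbV
    have hca1 : c ≤ a := le_trans (Nat.le_mul_of_pos_left c (by omega)) hca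
    by_cases hn : negs gs = 0
    · obtain ⟨h1, h0⟩ := hnum gs.length (by omega)
      exact cliqueLike_noNot_false hc hw hdw hI gs o V F hwf hB ho hn hF hCL h1 h0
        (Nat.div_mul_le_self _ _) (hdb.trans hbq) hbq (h2b.trans hbq) hca1
    -- the first NOT gate and the monotone function feeding it
    obtain ⟨pre, w₀, post, rfl, hpre⟩ := exists_first_notGate hn
    have hwfpre : WF pre := hwf.of_append_left
    have hBpre : ∀ g ∈ pre, g.fn ∈ monotoneBasis01 := fun g hg =>
      mem_monotoneBasis01_of_ne_not (hB g (by simp [hg])) (hpre g hg)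
    have hw₀ : OutOK pre.length w₀ := fun n hn => hwf.gateOK_mid (0 : Fin 1) n hn
    have hgmono : Monotone fun x => wireOf x (vals pre x) w₀ :=
      monotone_wireOf_vals01 pre hwfpre hBpre w₀ hw₀
    obtain ⟨h1, h0⟩ := hnum pre.length (by simp at hlen; omega)
    -- the dichotomy on the prefix, with `q = #V / c`
    rcases clique_dichotomy pre hwfpre hBpre w₀ hw₀ V hc hw hdw h1 h0 hI (Nat.div_mul_le_self _ _)
        (hdb.trans hbq) (h2b.trans hbq) with ⟨h, hh⟩ | ⟨Q, hQV, hQcard, hQ0⟩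
    · -- type 1: restrict to a monochromatic part of size `#V / c`
      obtain ⟨k, W, hWV, hWcard, hWmono⟩ := exists_mono_subset hc V h
      have hconst : ∀ x, wireOf (select W (colorTest V h) x)
          (vals pre (select W (colorTest V h) x)) w₀ = true := fun x =>
        apply_select_colorTest_eq_true hgmono hWV hWmono hh x
      obtain ⟨gs', o', hwf', hB', hlen', hnegs', ho', hF'⟩ :=
        killFirstNot W (colorTest V h) pre post w₀ o F true hwf hB ho hF hconst
      refine ih gs' o' W (a - c) _ hwf' hB' ho' (by omega) hF' (hCL.restrictColor hWV hca1 h)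
        (by omega) ?_ ?_
      · rw [hWcard, Nat.div_div_eq_div_mul, ← pow_succ']
        exact hbV
      · have : (R + 1 + 1) * c = (R + 1) * c + c := by ring
        omega
    · -- type 0: restrict to the clique `Q` of size `#V / c`
      have hconst : ∀ x, wireOf (select Q (fun _ => false) x)
          (vals pre (select Q (fun _ => false) x)) w₀ = false := fun x =>
        apply_select_bot_eq_false hgmono hQ0 x
      obtain ⟨gs', o', hwf', hB', hlen', hnegs', ho', hF'⟩ :=
        killFirstNot Q (fun _ => false) pre post w₀ o F false hwf hB ho hF hconst
      refine ih gs' o' Q a _ hwf' hB' ho' (by omega) hF' (hCL.restrictClique hQV) (by omega) ?_ ?_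
      · rw [hQcard, Nat.div_div_eq_div_mul, ← pow_succ']
        exact hbV
      · have : (R + 1 + 1) * c = (R + 1) * c + c := by ring
        omega

/-- **The finite lower bound.** Let `c ≥ 1`, `w ≥ 2`, `2 d² ≤ w`, `4 (w-1) ≤ c²`,
`4 (m^k + 2R) (w-1)^w ≤ c^d`, `d ≤ s`, `2 ≤ s`, `s ≤ m / c^(R+1)` and `(R+1) c ≤ s - 1`. Then every
circuit over `{∧₂, ∨₂, ¬}` with at most `R` NOT gates computing `CLIQUE(m, s)` has at least
`m^k` gates (Amano–Maruoka 2005, main theorem, finite form of this formalization).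
[cite: AmanoMaruoka2005, §1 main theorem] -/
theorem le_size_of_computes_cliqueFn {m s k R c d w : ℕ} (hc : 1 ≤ c) (hw : 2 ≤ w)
    (hdw : 2 * d ^ 2 ≤ w) (hI : 4 * (w - 1) ≤ c ^ 2)
    (hT : 4 * ((m ^ k + 2 * R) * (w - 1) ^ w) ≤ c ^ d) (hds : d ≤ s) (h2s : 2 ≤ s)
    (hsm : s ≤ m / c ^ (R + 1)) (hRs : (R + 1) * c ≤ s - 1)
    (C : Circuit (⊤ : SimpleGraph (Fin m)).edgeSet) (hC : C.IsOver deMorganBasis)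
    (hcomp : C.Computes (cliqueFn m s)) (hneg : C.negationCount ≤ R) : m ^ k ≤ C.size := by
  by_contra hlt
  push Not at hlt
  refine cliqueLike_induction (m := m) (T := m ^ k + 2 * R) hc hw hdw hT hI hds h2s R C.gates
    C.output univ (s - 1) (cliqueFn m s) (wf_gates C)
    (fun g hg => deMorganBasis_subset_deMorganBasis01 (hC g hg)) C.wf_output
    (by rw [← circuit_negationCount]; exact hneg) (fun x => by rw [← circuit_eval]; exact hcomp x)
    (cliqueLike_cliqueFn (by omega)) ?_ ?_ hRs
  · have : C.gates.length = C.size := rfl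
    omega
  · simpa using hsm

/-! ### Numerics -/

/-- `8 j + 10 ≤ 2^(j-1)` for `j ≥ 8`. [folklore] -/
theorem eight_mul_add_ten_le_two_pow {j : ℕ} (hj : 8 ≤ j) : 8 * j + 10 ≤ 2 ^ (j - 1) := by
  induction j, hj using Nat.le_induction with
  | base => norm_num
  | succ j hj ih =>
    have h8 : 8 ≤ 2 ^ (j - 1) :=
      calc (8 : ℕ) = 2 ^ 3 := by norm_num
        _ ≤ 2 ^ (j - 1) := Nat.pow_le_pow_right (by norm_num) (by omega)
    have h2 : 2 ^ (j + 1 - 1) = 2 ^ (j - 1) + 2 ^ (j - 1) := by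
      rw [show j + 1 - 1 = (j - 1) + 1 by omega, pow_succ]; ring
    omega

/-- Polynomial versus exponential: `9 (K+3)^8 ≤ 2^K` for `K ≥ 64`. [folklore] -/
theorem nine_mul_pow_eight_le_two_pow {K : ℕ} (hK : 64 ≤ K) : 9 * (K + 3) ^ 8 ≤ 2 ^ K := by
  have hj8 : 8 ≤ K / 8 := by omega
  have h1 : K + 3 ≤ 2 ^ (K / 8 - 1) := by
    have := eight_mul_add_ten_le_two_pow hj8
    omega
  calc 9 * (K + 3) ^ 8 ≤ 2 ^ 8 * (2 ^ (K / 8 - 1)) ^ 8 :=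
        Nat.mul_le_mul (by norm_num) (Nat.pow_le_pow_left h1 8)
    _ = 2 ^ (8 + (K / 8 - 1) * 8) := by rw [← pow_mul, ← pow_add]
    _ ≤ 2 ^ K := Nat.pow_le_pow_right (by norm_num) (by omega)

/-- `2^x + 2^y ≤ 2^(x + y + 1)`. [folklore] -/
theorem two_pow_add_two_pow_le (x y : ℕ) : 2 ^ x + 2 ^ y ≤ 2 ^ (x + y + 1) := by
  have hx : 2 ^ x ≤ 2 ^ (x + y) := Nat.pow_le_pow_right (by norm_num) (by omega)
  have hy : 2 ^ y ≤ 2 ^ (x + y) := Nat.pow_le_pow_right (by norm_num) (by omega)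
  rw [pow_succ]
  omega

/-- **The numerical side conditions** of `le_size_of_computes_cliqueFn` for the parameters of
`amano_maruoka_holds`, in terms of `L = log₂ m`, `K = log₂ L`, the budget `R ≤ K` and the
exponent `k`: with `Q₀ = L / (R+3)`, `ℓ = Q₀ - 1`, `d = (R+3)(K+1)`, `w = 2 d²` one has
`K + 1 ≤ ℓ`, `w + 2 ≤ 2 ℓ`, `1 ≤ Q₀` and `k (L+1) + R + w² + 4 ≤ ℓ d`, as soon as `K ≥ 64` and
`K ≥ 2k + 1`. [folklore] -/
theorem amano_maruoka_numerics {k L K R : ℕ} (hKL : 2 ^ K ≤ L) (hRK : R ≤ K) (hK : 64 ≤ K)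
    (hKk : 2 * k + 1 ≤ K) :
    K + 1 ≤ L / (R + 3) - 1 ∧
      2 * ((R + 3) * (K + 1)) ^ 2 + 2 ≤ 2 * (L / (R + 3) - 1) ∧ 1 ≤ L / (R + 3) ∧
      k * (L + 1) + R + (2 * ((R + 3) * (K + 1)) ^ 2) ^ 2 + 4 ≤
        (L / (R + 3) - 1) * ((R + 3) * (K + 1)) := by
  have hpoly : 9 * (K + 3) ^ 8 ≤ L := (nine_mul_pow_eight_le_two_pow hK).trans hKL
  have hR3 : R + 3 ≤ K + 3 := by omega
  have hd_le : (R + 3) * (K + 1) ≤ (K + 3) ^ 2 := by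
    rw [pow_two]; exact Nat.mul_le_mul hR3 (by omega)
  have hsq : ((R + 3) * (K + 1)) ^ 2 ≤ (K + 3) ^ 4 :=
    calc ((R + 3) * (K + 1)) ^ 2 ≤ ((K + 3) ^ 2) ^ 2 := Nat.pow_le_pow_left hd_le 2
      _ = (K + 3) ^ 4 := by ring
  have hw2 : (2 * ((R + 3) * (K + 1)) ^ 2) ^ 2 ≤ 4 * (K + 3) ^ 8 :=
    calc (2 * ((R + 3) * (K + 1)) ^ 2) ^ 2 = 4 * (((R + 3) * (K + 1)) ^ 2) ^ 2 := by ring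
      _ ≤ 4 * ((K + 3) ^ 4) ^ 2 := Nat.mul_le_mul_left 4 (Nat.pow_le_pow_left hsq 2)
      _ = 4 * (K + 3) ^ 8 := by ring
  have hK4 : K + 3 ≤ (K + 3) ^ 4 := Nat.le_self_pow (by norm_num) _
  have hK8 : K + 3 ≤ (K + 3) ^ 8 := Nat.le_self_pow (by norm_num) _
  have h58 : (K + 3) ^ 5 ≤ (K + 3) ^ 8 := Nat.pow_le_pow_right (by omega) (by norm_num)
  -- the quotient `Q₀ = L / (R+3)` is large
  have hX : ((K + 3) ^ 4 + 2) * (R + 3) ≤ L :=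
    calc ((K + 3) ^ 4 + 2) * (R + 3) ≤ ((K + 3) ^ 4 + 2) * (K + 3) := Nat.mul_le_mul_left _ hR3
      _ ≤ (2 * (K + 3) ^ 4) * (K + 3) := Nat.mul_le_mul_right _ (by omega)
      _ = 2 * (K + 3) ^ 5 := by ring
      _ ≤ 2 * (K + 3) ^ 8 := Nat.mul_le_mul_left 2 h58
      _ ≤ 9 * (K + 3) ^ 8 := by omega
      _ ≤ L := hpoly
  have hQ₀ : (K + 3) ^ 4 + 2 ≤ L / (R + 3) := (Nat.le_div_iff_mul_le (by omega)).2 hX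
  refine ⟨by omega, by omega, by omega, ?_⟩
  -- the main inequality
  set Q₀ := L / (R + 3) with hQ₀def
  set A := L - 2 * R - 5 with hA
  have hLA : L + 1 = A + (2 * R + 6) := by omega
  have hℓA : A ≤ (Q₀ - 1) * (R + 3) := by
    have h1 : (R + 3) * Q₀ + L % (R + 3) = L := Nat.div_add_mod L (R + 3)
    have h2 : L % (R + 3) < R + 3 := Nat.mod_lt _ (by omega)
    rw [Nat.sub_one_mul, Nat.mul_comm]
    omega
  have hAbig : 2 * R + (2 * ((R + 3) * (K + 1)) ^ 2) ^ 2 + 6 ≤ A := by omega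
  have hkK : 2 * k + 2 ≤ K + 1 := by omega
  calc k * (L + 1) + R + (2 * ((R + 3) * (K + 1)) ^ 2) ^ 2 + 4
      = k * A + (k * (2 * R + 6) + (R + (2 * ((R + 3) * (K + 1)) ^ 2) ^ 2 + 4)) := by
        rw [hLA]; ring
    _ ≤ k * A + (k * A + 2 * A) :=
        Nat.add_le_add_left (Nat.add_le_add (Nat.mul_le_mul_left k (by omega)) (by omega)) _
    _ = (2 * k + 2) * A := by ring
    _ ≤ (K + 1) * A := Nat.mul_le_mul_right A hkK
    _ ≤ (K + 1) * ((Q₀ - 1) * (R + 3)) := Nat.mul_le_mul_left _ hℓA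
    _ = (Q₀ - 1) * ((R + 3) * (K + 1)) := by ring

/-! ### The theorem -/

/-- **Proof of `amano_maruoka`** (Amano–Maruoka 2005, main theorem; Jukna 2012, §10.5): with
`L = log₂ m`, `K = log₂ L`, `R = ⌊K / 6⌋ = amanoMaruokaBudget m`, `c = 2 ^ (L / (R+3) - 1)` and
the clique size `s(m) = (R + 2) c`, every circuit over `{∧₂, ∨₂, ¬}` with at most `R` NOT gates
computing `CLIQUE(m, s(m))` has at least `m ^ k` gates once `K ≥ max 64 (2k+1)`, by
`le_size_of_computes_cliqueFn` with `d = (R+3)(K+1)`, `w = 2 d²` and `amano_maruoka_numerics`.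
[cite: AmanoMaruoka2005, §1 main theorem] -/
theorem amano_maruoka_holds : amano_maruoka := by
  -- the clique size
  let sz : ℕ → ℕ := fun m =>
    (amanoMaruokaBudget m + 2) * 2 ^ (Nat.log 2 m / (amanoMaruokaBudget m + 3) - 1)
  -- everything follows from `K = log₂ log₂ m ≥ K₀`
  have key : ∀ (k m : ℕ), 64 ≤ Nat.log 2 (Nat.log 2 m) → 2 * k + 1 ≤ Nat.log 2 (Nat.log 2 m) →
      (2 ≤ sz m ∧ sz m ≤ m) ∧
      ∀ C : Circuit (⊤ : SimpleGraph (Fin m)).edgeSet, C.IsOver deMorganBasis →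
        C.Computes (Complexity.cliqueFn m (sz m)) → C.negationCount ≤ amanoMaruokaBudget m →
          m ^ k ≤ C.size := by
    intro k m hK64 hKk
    -- names
    set L := Nat.log 2 m with hL
    set K := Nat.log 2 L with hK
    set R := amanoMaruokaBudget m with hR
    have hRK : R ≤ K := Nat.div_le_self _ _
    set Q₀ := L / (R + 3) with hQ₀
    set ℓ := Q₀ - 1 with hℓ
    set c := 2 ^ ℓ with hc
    set d := (R + 3) * (K + 1) with hd
    set w := 2 * d ^ 2 with hw
    have hsz : sz m = (R + 2) * c := rfl
    -- basic facts about the logarithms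
    have hL0 : L ≠ 0 := fun h => by rw [hK, h, Nat.log_zero_right] at hK64; omega
    have hm0 : m ≠ 0 := fun h => hL0 (by rw [hL, h, Nat.log_zero_right])
    have hKL : 2 ^ K ≤ L := Nat.pow_log_le_self 2 hL0
    have hLm : 2 ^ L ≤ m := Nat.pow_log_le_self 2 hm0
    have hmL : m < 2 ^ (L + 1) := Nat.lt_pow_succ_log_self (by norm_num) m
    obtain ⟨n1, n2, n3, n4⟩ := amano_maruoka_numerics (k := k) hKL hRK hK64 hKk
    -- the side conditions
    have hc1 : 1 ≤ c := Nat.one_le_two_pow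
    have hd3 : 3 ≤ d := by
      calc (3 : ℕ) = 3 * 1 := rfl
        _ ≤ (R + 3) * (K + 1) := Nat.mul_le_mul (by omega) (by omega)
    have hw2 : 2 ≤ w := by
      have : 1 ≤ d ^ 2 := Nat.one_le_pow _ _ (by omega)
      omega
    have hI : 4 * (w - 1) ≤ c ^ 2 :=
      calc 4 * (w - 1) ≤ 4 * 2 ^ w := Nat.mul_le_mul_left 4 ((Nat.sub_le w 1).trans Nat.lt_two_pow_self.le)
        _ = 2 ^ (w + 2) := by rw [pow_add]; ring
        _ ≤ 2 ^ (2 * ℓ) := Nat.pow_le_pow_right (by norm_num) n2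
        _ = c ^ 2 := by rw [hc, ← pow_mul, Nat.mul_comm]
    have hT : 4 * ((m ^ k + 2 * R) * (w - 1) ^ w) ≤ c ^ d := by
      have h1 : m ^ k ≤ 2 ^ (k * (L + 1)) := by
        rw [Nat.mul_comm, pow_mul]; exact Nat.pow_le_pow_left hmL.le k
      have h2 : 2 * R ≤ 2 ^ (R + 1) := by
        rw [pow_succ]; have := Nat.lt_two_pow_self (n := R); omega
      have h3 : m ^ k + 2 * R ≤ 2 ^ (k * (L + 1) + R + 2) :=
        (Nat.add_le_add h1 h2).trans ((two_pow_add_two_pow_le _ _).trans (le_of_eq (by ring_nf)))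
      have h4 : (w - 1) ^ w ≤ 2 ^ (w ^ 2) :=
        calc (w - 1) ^ w ≤ (2 ^ w) ^ w := Nat.pow_le_pow_left ((Nat.sub_le w 1).trans Nat.lt_two_pow_self.le) w
          _ = 2 ^ (w ^ 2) := by rw [← pow_mul, pow_two]
      calc 4 * ((m ^ k + 2 * R) * (w - 1) ^ w)
          ≤ 4 * (2 ^ (k * (L + 1) + R + 2) * 2 ^ (w ^ 2)) := Nat.mul_le_mul_left 4 (Nat.mul_le_mul h3 h4)
        _ = 2 ^ (k * (L + 1) + R + w ^ 2 + 4) := by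
          rw [show (4 : ℕ) = 2 ^ 2 by norm_num, ← pow_add, ← pow_add]; ring_nf
        _ ≤ 2 ^ (ℓ * d) := Nat.pow_le_pow_right (by norm_num) n4
        _ = c ^ d := by rw [hc, ← pow_mul]
    have hds : d ≤ (R + 2) * c := by
      have h1 : 2 * (K + 1) ≤ 2 ^ (K + 1) := by
        rw [pow_succ]; have := Nat.lt_two_pow_self (n := K); omega
      have h2 : 2 ^ (K + 1) ≤ c := Nat.pow_le_pow_right (by norm_num) n1
      calc d = (R + 3) * (K + 1) := rfl
        _ ≤ (R + 2) * (2 * (K + 1)) := by nlinarith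
        _ ≤ (R + 2) * c := Nat.mul_le_mul_left _ (h1.trans h2)
    have h2s : 2 ≤ (R + 2) * c := by nlinarith
    have hsm : (R + 2) * c ≤ m / c ^ (R + 1) := by
      rw [Nat.le_div_iff_mul_le (Nat.pow_pos (by omega))]
      have hexp : R + 1 + ℓ * (R + 2) ≤ L := by
        have h1 : Q₀ * (R + 3) ≤ L := Nat.div_mul_le_self L (R + 3)
        have h2 : (ℓ + 1) * (R + 3) = ℓ * (R + 2) + ℓ + R + 3 := by ring
        have h3 : ℓ + 1 = Q₀ := by omega
        rw [h3] at h2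
        omega
      calc (R + 2) * c * c ^ (R + 1) = (R + 2) * 2 ^ (ℓ * (R + 2)) := by
            rw [hc, Nat.mul_assoc, ← pow_succ', ← pow_mul]
        _ ≤ 2 ^ (R + 1) * 2 ^ (ℓ * (R + 2)) :=
            Nat.mul_le_mul_right _ (by rw [pow_succ]; have := Nat.lt_two_pow_self (n := R); omega)
        _ = 2 ^ (R + 1 + ℓ * (R + 2)) := by rw [← pow_add]
        _ ≤ 2 ^ L := Nat.pow_le_pow_right (by norm_num) hexp
        _ ≤ m := hLm
    have hRs : (R + 1) * c ≤ (R + 2) * c - 1 := by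
      have : (R + 2) * c = (R + 1) * c + c := by ring
      omega
    refine ⟨⟨h2s, hsm.trans (Nat.div_le_self _ _)⟩, fun C hC hcomp hneg => ?_⟩
    exact le_size_of_computes_cliqueFn hc1 hw2 le_rfl hI hT hds h2s hsm hRs C hC hcomp hneg
  -- thresholds: `K ≥ K₀` as soon as `m ≥ 2 ^ 2 ^ K₀` (no tactic below sees these towers)
  have large : ∀ K₀ : ℕ, ∀ m ≥ 2 ^ (2 ^ K₀), K₀ ≤ Nat.log 2 (Nat.log 2 m) := fun K₀ m hm =>
    Nat.le_log_of_pow_le Nat.one_lt_two (Nat.le_log_of_pow_le Nat.one_lt_two hm)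
  have thr : ∀ K₀ k : ℕ, 64 ≤ K₀ → 2 * k + 1 ≤ K₀ → ∀ m ≥ 2 ^ (2 ^ K₀),
      (2 ≤ sz m ∧ sz m ≤ m) ∧
      ∀ C : Circuit (⊤ : SimpleGraph (Fin m)).edgeSet, C.IsOver deMorganBasis →
        C.Computes (Complexity.cliqueFn m (sz m)) → C.negationCount ≤ amanoMaruokaBudget m →
          m ^ k ≤ C.size := fun K₀ k h1 h2 m hm =>
    key k m (h1.trans (large K₀ m hm)) (h2.trans (large K₀ m hm))
  have h64 : (64 : ℕ) ≤ 64 := le_rfl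
  have h01 : 2 * 0 + 1 ≤ 64 := by norm_num
  have hmax1 : ∀ k : ℕ, 64 ≤ max 64 (2 * k + 1) := fun k => le_max_left _ _
  have hmax2 : ∀ k : ℕ, 2 * k + 1 ≤ max 64 (2 * k + 1) := fun k => le_max_right _ _
  exact ⟨sz, Filter.eventually_atTop.2 ⟨2 ^ (2 ^ 64), fun m hm => (thr 64 0 h64 h01 m hm).1⟩,
    fun k => Filter.eventually_atTop.2 ⟨2 ^ (2 ^ max 64 (2 * k + 1)), fun m hm =>
      (thr _ k (hmax1 k) (hmax2 k) m hm).2⟩⟩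

end Literature.Computability.Complexity
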